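import Mathlib
import HarnessLib
import Summits.HubbardSuperconductivity.HubbardSuperconductivity.Theorems.KLProgrammeC4aInvariantDefs

/-!
# Route `KLProgramme` — crux C4a: REGULARITY OF THE CO-MOVING CHART — the perturbed Fermi radius is jointly smooth in (angle, level),
# hence `levelPoint μ K` is jointly `C^∞` in `(ρ, ϑ)`

Cell `gate-hubbard-kl`, lane hubbard-kl-c4a-1 (memo HOME/hubbard-kl-c4a-1/C4A-PLAN.md §2c, (L2)).  Helper for the ENGINE / engine-flow item
(stmt-HubbardSuperconductivity-20236; sixth stub).  The co-moving integral lemma (`…C4aCoMovingIntegral`, `norm_iteratedDeriv_coMoving_integral_le`)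
needs the integrand `(θ, ϑ) ↦ w(ϑ)·V(Φ(0,θ), Φ(ρ,ϑ))` jointly smooth, where `Φ(ρ, ϑ) = levelPoint μ K ρ ϑ = toLp (klFermiPoint (μ + ρ) K ϑ)` is the
FS-adapted chart of the frame band (`…C4aInvariantDefs`).  The tree has the regularity of `θ ↦ klFermiPoint μ K θ` at FIXED level
(`contDiff_klFermiPoint`, BGM 2006 Lemma 2.1 via the implicit function theorem, …H10TwoPointLimitFrameFermiPoint / …PerturbedFermiRadiusSmooth);
this file runs the same implicit function theorem with the LEVEL AS A SECOND PARAMETER: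

* §1 `contDiffAt_perturbedFermiRadius_joint`: for a `Cⁿ` perturbation `δ` (`n ≥ 1`) with `|δ| ≤ κ₀`, `‖Dδ‖ ≤ κ₁ < Dt_min` on the closed square and a
  level `μ₀` with `[μ₀ − κ₀, μ₀ + κ₀] ⊂ (a, b)` STRICTLY, the canonical radius `(θ, μ) ↦ perturbedFermiRadius δ μ θ` is `Cⁿ` at `(θ₀, μ₀)` jointly
  (implicit function of `G̃((θ, μ), t) = ε₀(t·dir θ) + δ(t·dir θ) − μ`, radial partial `≥ Dt_min − κ₁ > 0`, identified with the canonical selection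
  near `(θ₀, μ₀)` by ray-wise uniqueness `shifted_unique` at every nearby level);
* `hasDerivAt_perturbedFermiRadius_level`, `deriv_perturbedFermiRadius_level_pos_le`: the radial Jacobian factor
  `∂_μ u = 1/(∂_tε₀ + Dδ[dir]) ∈ (0, 1/(Dt_min − κ₁)]` of the chart;
* §2 the frame instance: `contDiffAt_levelRadius` / `contDiffAt_levelPoint` — for a frame `K` of `C²` size `A` (`2A < Dt_min`) and `ρ₀` with
  `[μ + ρ₀ − A, μ + ρ₀ + A] ⊂ (a, b)`, the maps `(ρ, ϑ) ↦ u_K(μ + ρ; ϑ)` and `(ρ, ϑ) ↦ levelPoint μ K ρ ϑ` are `C^∞` at `(ρ₀, ϑ₀)`, and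
  `contDiffOn_levelPoint`: `C^∞` on the open tube `{|ρ| < r} × ℝ` when `[μ − r − A, μ + r + A] ⊂ (a, b)`.

Pure calculus on the tree's objects; nothing is asserted about the Hubbard model.  References: BGM 2006 §2.4 Lemma 2.1
[cite: BenfattoGiulianiMastropietro2006]; FST II (H2)(2) (the radial/tangential coordinates `p(ρ, θ)` with `e(p(ρ,θ)) = ρ`).
-/

noncomputable section

namespace Summit.HubbardSuperconductivity.HubbardSuperconductivity.Theorems.C4a

set_option linter.dupNamespace false -- summit = problem name (single-conjunct summit), D-0017

open Real Set Filter
open scoped Topology ContDiff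
open Literature.MathematicalPhysics.QuantumLattice Literature.MathematicalPhysics.QuantumLattice.BandSectorCounting
open Summit.HubbardSuperconductivity.HubbardSuperconductivity.Theorems.PerturbedFermiCurve
open Summit.HubbardSuperconductivity.HubbardSuperconductivity.Theorems.DispersionFlow
open Summit.HubbardSuperconductivity.HubbardSuperconductivity.Theorems.KLRegimeSplit

/-! ## §1 The canonical perturbed Fermi radius is jointly smooth in (angle, level) -/

section Joint

variable {a b : ℝ} (B : BandBounds a b) {δ : (Fin 2 → ℝ) → ℝ} {n : WithTop ℕ∞} (hδs : ContDiff ℝ n δ) (hn : n ≠ 0)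
  {κ₀ κ₁ : ℝ} (hδ : ∀ k : Fin 2 → ℝ, (∀ i, |k i| ≤ π) → |δ k| ≤ κ₀)
  (hκ : ∀ k : Fin 2 → ℝ, (∀ i, |k i| ≤ π) → ‖fderiv ℝ δ k‖ ≤ κ₁) (hκ₁ : κ₁ < B.Dtmin)
  {μ₀ : ℝ} (hlo : a < μ₀ - κ₀) (hhi : μ₀ + κ₀ < b)
include B hδs hn hδ hκ hκ₁ hlo hhi

/-- **Joint smoothness of the canonical perturbed Fermi radius in (angle, level).**  Under BGM Lemma 2.1's hypotheses with the level range
STRICTLY inside the band range, `(θ, μ) ↦ perturbedFermiRadius δ μ θ` is `Cⁿ` at `(θ₀, μ₀)`. -/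
theorem contDiffAt_perturbedFermiRadius_joint (θ₀ : ℝ) :
    ContDiffAt ℝ n (fun p : ℝ × ℝ => perturbedFermiRadius δ p.2 p.1) (θ₀, μ₀) := by
  -- the canonical selection is a root at every level near μ₀
  have hδc : Continuous δ := hδs.continuous
  have hdiffδ : ∀ k, DifferentiableAt ℝ δ k := fun k => (hδs.differentiable hn) k
  set U : ℝ × ℝ → ℝ := fun p => perturbedFermiRadius δ p.2 p.1 with hUdef
  have hUroot : ∀ p : ℝ × ℝ, a ≤ p.2 - κ₀ → p.2 + κ₀ ≤ b → IsBandFermiRadius (p.2 - δ (U p • dir p.1)) p.1 (U p) :=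
    fun p h1 h2 => isBandFermiRadius_perturbedFermiRadius B hδc hδ h1 h2 p.1
  have hroot := hUroot (θ₀, μ₀) hlo.le hhi.le
  -- the level function with the level as a parameter: G̃((θ, μ), t) = ε₀(t dir θ) + δ(t dir θ) − μ
  set Gp : ℝ × ℝ → ℝ := fun p => rayDispersion p + δ (p.2 • dir p.1) with hGpdef
  set Al : (ℝ × ℝ) × ℝ →L[ℝ] ℝ × ℝ :=
    ((ContinuousLinearMap.fst ℝ ℝ ℝ).comp (ContinuousLinearMap.fst ℝ (ℝ × ℝ) ℝ)).prod (ContinuousLinearMap.snd ℝ (ℝ × ℝ) ℝ) with hAldef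
  set Sl : (ℝ × ℝ) × ℝ →L[ℝ] ℝ := (ContinuousLinearMap.snd ℝ ℝ ℝ).comp (ContinuousLinearMap.fst ℝ (ℝ × ℝ) ℝ) with hSldef
  set G : (ℝ × ℝ) × ℝ → ℝ := fun q => Gp (Al q) - Sl q with hGdef
  have hGapply : ∀ θ μ t, G ((θ, μ), t) = rayDispersion (θ, t) + δ (t • dir θ) - μ := by
    intro θ μ t; simp [hGdef, hGpdef, hAldef, hSldef]
  have hGp : ContDiff ℝ n Gp := contDiff_pertLevel hδs
  have hGcd : ContDiff ℝ n G := (hGp.comp Al.contDiff).sub Sl.contDiff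
  have cdf : ContDiffAt ℝ n G ((θ₀, μ₀), U (θ₀, μ₀)) := hGcd.contDiffAt
  -- the radial partial is invertible
  have hGt : 0 < rayDispersionDt θ₀ (U (θ₀, μ₀)) + fderiv ℝ δ (U (θ₀, μ₀) • dir θ₀) (dir θ₀) :=
    pertDt_pos B hδ hlo.le hhi.le hκ hκ₁ (u := fun θ => U (θ, μ₀)) (fun θ => hUroot (θ, μ₀) hlo.le hhi.le) θ₀
  have hGpdiff : DifferentiableAt ℝ Gp (θ₀, U (θ₀, μ₀)) := (hGp.differentiable hn) _
  have hAlx : Al ((θ₀, μ₀), U (θ₀, μ₀)) = (θ₀, U (θ₀, μ₀)) := by simp [hAldef]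
  have hfderivG : fderiv ℝ G ((θ₀, μ₀), U (θ₀, μ₀)) = (fderiv ℝ Gp (θ₀, U (θ₀, μ₀))).comp Al - Sl := by
    have hg : HasFDerivAt Gp (fderiv ℝ Gp (θ₀, U (θ₀, μ₀))) (Al ((θ₀, μ₀), U (θ₀, μ₀))) := by
      rw [hAlx]; exact hGpdiff.hasFDerivAt
    have h1 : HasFDerivAt (fun q => Gp (Al q)) ((fderiv ℝ Gp (θ₀, U (θ₀, μ₀))).comp Al) ((θ₀, μ₀), U (θ₀, μ₀)) :=
      hg.comp ((θ₀, μ₀), U (θ₀, μ₀)) Al.hasFDerivAt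
    have h2 : HasFDerivAt G ((fderiv ℝ Gp (θ₀, U (θ₀, μ₀))).comp Al - Sl) ((θ₀, μ₀), U (θ₀, μ₀)) :=
      h1.sub Sl.hasFDerivAt
    exact h2.fderiv
  have hinr : ∀ c : ℝ, (fderiv ℝ G ((θ₀, μ₀), U (θ₀, μ₀)) ∘L ContinuousLinearMap.inr ℝ (ℝ × ℝ) ℝ) c =
      c * (rayDispersionDt θ₀ (U (θ₀, μ₀)) + fderiv ℝ δ (U (θ₀, μ₀) • dir θ₀) (dir θ₀)) := by
    intro c
    have hA : Al ((0 : ℝ × ℝ), c) = ((0 : ℝ), c) := by simp [hAldef]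
    have hS : Sl ((0 : ℝ × ℝ), c) = 0 := by simp [hSldef]
    rw [ContinuousLinearMap.comp_apply, ContinuousLinearMap.inr_apply, hfderivG]
    show (fderiv ℝ Gp (θ₀, U (θ₀, μ₀))) (Al ((0 : ℝ × ℝ), c)) - Sl ((0 : ℝ × ℝ), c) = _
    rw [hA, hS, fderiv_pertLevel_apply hGpdiff (hdiffδ _)]
    ring
  have if₂ : (fderiv ℝ G ((θ₀, μ₀), U (θ₀, μ₀)) ∘L ContinuousLinearMap.inr ℝ (ℝ × ℝ) ℝ).IsInvertible := by
    refine ⟨ContinuousLinearEquiv.unitsEquivAut ℝ (Units.mk0 _ hGt.ne'), ContinuousLinearMap.ext_ring ?_⟩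
    rw [ContinuousLinearEquiv.coe_coe, ContinuousLinearEquiv.unitsEquivAut_apply, Units.val_mk0, hinr, one_mul]
  -- the implicit function at ((θ₀, μ₀), U(θ₀, μ₀))
  have hψ : ContDiffAt ℝ n (cdf.implicitFunction hn if₂) (θ₀, μ₀) := cdf.contDiffAt_implicitFunction hn if₂
  have hψ0 : cdf.implicitFunction hn if₂ (θ₀, μ₀) = U (θ₀, μ₀) := cdf.implicitFunction_apply_self hn if₂
  have hψeq : ∀ᶠ p in 𝓝 (θ₀, μ₀), G (p, cdf.implicitFunction hn if₂ p) = G ((θ₀, μ₀), U (θ₀, μ₀)) :=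
    cdf.eventually_apply_implicitFunction hn if₂
  have hG0 : G ((θ₀, μ₀), U (θ₀, μ₀)) = 0 := by
    rw [hGapply]; linarith [hroot.2]
  -- its values stay inside the open ray segment, and the level stays admissible, near (θ₀, μ₀)
  have hI := mem_Ioo_of_shifted B hδ hlo.le hhi.le hroot
  have hψc : ContinuousAt (cdf.implicitFunction hn if₂) (θ₀, μ₀) := hψ.continuousAt
  have hev1 : ∀ᶠ p in 𝓝 (θ₀, μ₀), 0 < cdf.implicitFunction hn if₂ p :=
    hψc.eventually (lt_mem_nhds (by rw [hψ0]; exact hI.1))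
  have hexitc : Continuous fun p : ℝ × ℝ => π / ‖dir p.1‖ :=
    continuous_const.div (continuous_norm_dir.comp continuous_fst) fun p => (norm_dir_pos p.1).ne'
  have hev2 : ∀ᶠ p in 𝓝 (θ₀, μ₀), 0 < π / ‖dir p.1‖ - cdf.implicitFunction hn if₂ p :=
    (hexitc.continuousAt.sub hψc).eventually
      (lt_mem_nhds (show (0 : ℝ) < π / ‖dir θ₀‖ - cdf.implicitFunction hn if₂ (θ₀, μ₀) by rw [hψ0]; linarith [hI.2]))
  have hev3 : ∀ᶠ p : ℝ × ℝ in 𝓝 (θ₀, μ₀), a < p.2 - κ₀ ∧ p.2 + κ₀ < b := by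
    have hc : Continuous fun p : ℝ × ℝ => p.2 := continuous_snd
    have h1 : ∀ᶠ p : ℝ × ℝ in 𝓝 (θ₀, μ₀), a + κ₀ < p.2 := hc.continuousAt.eventually (lt_mem_nhds (by simp; linarith))
    have h2 : ∀ᶠ p : ℝ × ℝ in 𝓝 (θ₀, μ₀), p.2 < b - κ₀ := hc.continuousAt.eventually (gt_mem_nhds (by simp; linarith))
    filter_upwards [h1, h2] with p h1 h2
    exact ⟨by linarith, by linarith⟩
  -- so by ray-wise uniqueness at each nearby level they are the canonical radii
  have heq : U =ᶠ[𝓝 (θ₀, μ₀)] cdf.implicitFunction hn if₂ := by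
    filter_upwards [hψeq, hev1, hev2, hev3] with p hp h1 h2 h3
    obtain ⟨θ, μ⟩ := p
    have hψroot : IsBandFermiRadius (μ - δ (cdf.implicitFunction hn if₂ (θ, μ) • dir θ)) θ (cdf.implicitFunction hn if₂ (θ, μ)) := by
      refine ⟨⟨h1.le, ?_⟩, ?_⟩
      · rw [← le_div_iff₀ (norm_dir_pos θ)]; simp only at h2; linarith
      · show rayDispersion (θ, cdf.implicitFunction hn if₂ (θ, μ)) = μ - δ (cdf.implicitFunction hn if₂ (θ, μ) • dir θ)
        have : rayDispersion (θ, cdf.implicitFunction hn if₂ (θ, μ)) + δ (cdf.implicitFunction hn if₂ (θ, μ) • dir θ) - μ = 0 := by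
          rw [← hGapply, hp, hG0]
        linarith
    simp only at h3
    exact shifted_unique B hδ h3.1.le h3.2.le (radialLipschitz_of_fderiv_le (fun k _ => hdiffδ k) hκ θ) hκ₁
      (hUroot (θ, μ) h3.1.le h3.2.le) hψroot
  exact hψ.congr_of_eventuallyEq heq


/-- **The level derivative of the canonical radius**: `∂_μ u(θ₀; μ₀) = 1/(∂_t ε₀ + Dδ[dir θ₀])` at the Fermi point — the radial Jacobian
factor of the co-moving chart (`det DΦ = u·∂_ρ u` in polar form), positive and at most `1/(Dt_min − κ₁)`. -/
theorem hasDerivAt_perturbedFermiRadius_level (θ₀ : ℝ) :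
    HasDerivAt (fun μ : ℝ => perturbedFermiRadius δ μ θ₀)
      (rayDispersionDt θ₀ (perturbedFermiRadius δ μ₀ θ₀) +
        fderiv ℝ δ (perturbedFermiRadius δ μ₀ θ₀ • dir θ₀) (dir θ₀))⁻¹ μ₀ := by
  have hδc : Continuous δ := hδs.continuous
  have hdiffδ : ∀ k, DifferentiableAt ℝ δ k := fun k => (hδs.differentiable hn) k
  set u : ℝ → ℝ := fun μ => perturbedFermiRadius δ μ θ₀ with hudef
  -- `u` is differentiable at `μ₀` (joint smoothness composed with `μ ↦ (θ₀, μ)`)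
  have hj := contDiffAt_perturbedFermiRadius_joint B hδs hn hδ hκ hκ₁ hlo hhi θ₀
  have hline : ContDiffAt ℝ n (fun μ : ℝ => ((θ₀, μ) : ℝ × ℝ)) μ₀ := (contDiff_const.prodMk contDiff_id).contDiffAt
  have hu : DifferentiableAt ℝ u μ₀ := by
    have := (hj.comp μ₀ hline).differentiableAt hn
    exact this
  -- differentiate the identity `ε₀(u(μ)·dir θ₀) + δ(u(μ)·dir θ₀) = μ` near `μ₀`
  have hev : ∀ᶠ μ in 𝓝 μ₀, rayDispersion (θ₀, u μ) + δ (u μ • dir θ₀) = μ := by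
    have h1 : ∀ᶠ μ : ℝ in 𝓝 μ₀, a + κ₀ < μ := lt_mem_nhds (by linarith)
    have h2 : ∀ᶠ μ : ℝ in 𝓝 μ₀, μ < b - κ₀ := gt_mem_nhds (by linarith)
    filter_upwards [h1, h2] with μ h1 h2
    have hr := (isBandFermiRadius_perturbedFermiRadius B hδc hδ (μ := μ) (by linarith) (by linarith) θ₀).2
    simp only [hudef]
    linarith
  set D : ℝ := rayDispersionDt θ₀ (u μ₀) + fderiv ℝ δ (u μ₀ • dir θ₀) (dir θ₀) with hDdef
  have hD : 0 < D :=
    pertDt_pos B hδ hlo.le hhi.le hκ hκ₁ (u := fun θ => perturbedFermiRadius δ μ₀ θ)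
      (fun θ => isBandFermiRadius_perturbedFermiRadius B hδc hδ hlo.le hhi.le θ) θ₀
  have hchain : HasDerivAt (fun μ => rayDispersion (θ₀, u μ) + δ (u μ • dir θ₀)) (D * deriv u μ₀) μ₀ := by
    have h := (hasDerivAt_pertLevel_radius (θ := θ₀) (t := u μ₀) (hdiffδ _)).comp μ₀ hu.hasDerivAt
    simpa [hDdef, mul_comm, Function.comp_def] using h
  have hid : HasDerivAt (fun μ => rayDispersion (θ₀, u μ) + δ (u μ • dir θ₀)) 1 μ₀ :=
    (hasDerivAt_id μ₀).congr_of_eventuallyEq hev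
  have hmul : D * deriv u μ₀ = 1 := hchain.unique hid
  have hderiv : deriv u μ₀ = D⁻¹ := by
    field_simp
    linarith [hmul]
  rw [← hderiv]
  exact hu.hasDerivAt

/-- **Bounds on the level derivative**: `0 < ∂_μ u ≤ 1/(Dt_min − κ₁)`. -/
theorem deriv_perturbedFermiRadius_level_pos_le (θ₀ : ℝ) :
    0 < deriv (fun μ : ℝ => perturbedFermiRadius δ μ θ₀) μ₀ ∧
      deriv (fun μ : ℝ => perturbedFermiRadius δ μ θ₀) μ₀ ≤ (B.Dtmin - κ₁)⁻¹ := by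
  have hδc : Continuous δ := hδs.continuous
  have h := (hasDerivAt_perturbedFermiRadius_level B hδs hn hδ hκ hκ₁ hlo hhi θ₀).deriv
  rw [h]
  have hroot : ∀ θ, IsBandFermiRadius (μ₀ - δ (perturbedFermiRadius δ μ₀ θ • dir θ)) θ (perturbedFermiRadius δ μ₀ θ) :=
    fun θ => isBandFermiRadius_perturbedFermiRadius B hδc hδ hlo.le hhi.le θ
  have hge := Dtmin_sub_le_pertDt B hδ hlo.le hhi.le hκ (u := fun θ => perturbedFermiRadius δ μ₀ θ) hroot θ₀
  have hpos : 0 < B.Dtmin - κ₁ := by linarith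
  exact ⟨inv_pos.2 (hpos.trans_le hge), inv_anti₀ hpos hge⟩

end Joint

/-! ## §2 The frame instance: `levelPoint μ K` is jointly `C^∞` in `(ρ, ϑ)` -/

section Frame

variable {a b : ℝ} (B : BandBounds a b) {K : TrigPolyC4v} {A : ℝ}
  (hA : ∀ p : Momentum, ∀ j ≤ 2, ‖iteratedFDeriv ℝ j (frameShift K) p‖ ≤ A) (hADt : 2 * A < B.Dtmin)
  {μ ρ₀ : ℝ} (hlo : a < μ + ρ₀ - A) (hhi : μ + ρ₀ + A < b)
include B hA hADt hlo hhi

/-- **The frame's level radius `(ρ, ϑ) ↦ u_K(μ + ρ; ϑ)` is jointly `C^∞`** at `(ρ₀, ϑ₀)` when `[μ + ρ₀ − A, μ + ρ₀ + A] ⊂ (a, b)`. -/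
theorem contDiffAt_levelRadius {m : ℕ∞} (ϑ₀ : ℝ) :
    ContDiffAt ℝ m (fun p : ℝ × ℝ => perturbedFermiRadius (fun k : Fin 2 → ℝ => -K.eval k) (μ + p.1) p.2) (ρ₀, ϑ₀) := by
  have hC : ContDiff ℝ ((⊤ : ℕ∞) : WithTop ℕ∞) (fun p : Fin 2 → ℝ => -K.eval p) := by
    rw [← frameShift_toLp_eq_neg_eval]; exact contDiff_frameShift_toLp K
  have hδ : ∀ k : Fin 2 → ℝ, (∀ i, |k i| ≤ π) → |(fun p : Fin 2 → ℝ => -K.eval p) k| ≤ A := fun k _ => by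
    simpa [frameShift_toLp] using abs_frameShift_toLp_le hA k
  have hκ : ∀ k : Fin 2 → ℝ, (∀ i, |k i| ≤ π) → ‖fderiv ℝ (fun p : Fin 2 → ℝ => -K.eval p) k‖ ≤ 2 * A := fun k _ => by
    rw [← frameShift_toLp_eq_neg_eval]; exact norm_fderiv_frameShift_toLp_le hA k
  have hj := contDiffAt_perturbedFermiRadius_joint B hC (by simp) hδ hκ hADt (μ₀ := μ + ρ₀) hlo hhi ϑ₀
  -- compose with the affine map (ρ, ϑ) ↦ (ϑ, μ + ρ)
  have haff : ContDiff ℝ ((⊤ : ℕ∞) : WithTop ℕ∞) (fun p : ℝ × ℝ => ((p.2, μ + p.1) : ℝ × ℝ)) :=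
    contDiff_snd.prodMk (contDiff_const.add contDiff_fst)
  have hcomp : ContDiffAt ℝ ((⊤ : ℕ∞) : WithTop ℕ∞)
      ((fun q : ℝ × ℝ => perturbedFermiRadius (fun k : Fin 2 → ℝ => -K.eval k) q.2 q.1) ∘
        fun p : ℝ × ℝ => ((p.2, μ + p.1) : ℝ × ℝ)) (ρ₀, ϑ₀) :=
    ContDiffAt.comp (ρ₀, ϑ₀) hj haff.contDiffAt
  exact (hcomp.of_le (by exact_mod_cast le_top)).congr_of_eventuallyEq (Eventually.of_forall fun p => rfl)

/-- **`levelPoint μ K` is jointly `C^∞`** at `(ρ₀, ϑ₀)` when `[μ + ρ₀ − A, μ + ρ₀ + A] ⊂ (a, b)`. -/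
theorem contDiffAt_levelPoint {m : ℕ∞} (ϑ₀ : ℝ) :
    ContDiffAt ℝ m (fun p : ℝ × ℝ => levelPoint μ K p.1 p.2) (ρ₀, ϑ₀) := by
  have h1 := contDiffAt_levelRadius B hA hADt hlo hhi (m := m) ϑ₀
  have h2 : ContDiffAt ℝ m (fun p : ℝ × ℝ => dir p.2) (ρ₀, ϑ₀) := (contDiff_dir.comp contDiff_snd).contDiffAt
  have h3 : ContDiffAt ℝ m (fun p : ℝ × ℝ => perturbedFermiRadius (fun k : Fin 2 → ℝ => -K.eval k) (μ + p.1) p.2 • dir p.2)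
      (ρ₀, ϑ₀) := h1.smul h2
  have h4 : ContDiffAt ℝ m (fun p : ℝ × ℝ => (WithLp.toLp 2
      (perturbedFermiRadius (fun k : Fin 2 → ℝ => -K.eval k) (μ + p.1) p.2 • dir p.2) : Momentum)) (ρ₀, ϑ₀) :=
    (PiLp.continuousLinearEquiv 2 ℝ (fun _ : Fin 2 => ℝ)).symm.contDiff.contDiffAt.comp (ρ₀, ϑ₀) h3
  exact h4.congr_of_eventuallyEq (Eventually.of_forall fun p => rfl)

end Frame

section Tube

variable {a b : ℝ} (B : BandBounds a b) {K : TrigPolyC4v} {A : ℝ}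
  (hA : ∀ p : Momentum, ∀ j ≤ 2, ‖iteratedFDeriv ℝ j (frameShift K) p‖ ≤ A) (hADt : 2 * A < B.Dtmin)
  {μ r : ℝ} (hlo : a < μ - r - A) (hhi : μ + r + A < b)
include B hA hADt hlo hhi

/-- **`levelPoint μ K` is `C^∞` on the open tube `{|ρ| < r} × ℝ`** when `[μ − r − A, μ + r + A] ⊂ (a, b)`. -/
theorem contDiffOn_levelPoint {m : ℕ∞} :
    ContDiffOn ℝ m (fun p : ℝ × ℝ => levelPoint μ K p.1 p.2) ({ρ : ℝ | |ρ| < r} ×ˢ univ) := by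
  intro p hp
  have hρ : |p.1| < r := (mem_prod.1 hp).1
  have h1 : a < μ + p.1 - A := by have := (abs_lt.1 hρ).1; linarith
  have h2 : μ + p.1 + A < b := by have := (abs_lt.1 hρ).2; linarith
  have h := contDiffAt_levelPoint B hA hADt (μ := μ) (ρ₀ := p.1) h1 h2 (m := m) p.2
  exact h.contDiffWithinAt

end Tube

end Summit.HubbardSuperconductivity.HubbardSuperconductivity.Theorems.C4a
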